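import Mathlib.Algebra.BigOperators.Group.Finset.Sigma
import Mathlib.Data.Nat.Choose.Bounds
import Literature.Barriers.ValiantsHypothesis.UnpaddedShiftedPartialsIMM
import Literature.Barriers.ValiantsHypothesis.UnpaddedShiftedPartialsQuadric
import Literature.Barriers.ValiantsHypothesis.ShiftedPartialsPermanentSide
import HarnessLib

/-!
# Shifted partial derivatives of `perm_m` versus `IMM^m_n`: the range established by the printed
proof of Gesmundo–Landsberg's Theorem 2 — PROVED

Gesmundo–Landsberg (*Explicit polynomial sequences with maximal spaces of partial derivatives and a
question of K. Mulmuley*, Theory of Computing 15 (2019), art. 3 = arXiv:1705.03866), Thm. 2: "If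
`n > m⁵`, then `perm_m` cannot be separated from `IMM^m_n` by the method of shifted partial
derivatives. More precisely, given any linear inclusion `ℂ^{m²} ⊆ ℂ^{mn²}` ... for all choices of
`e`, `τ`, `dim⟨∂^{=e} perm_m⟩_{=τ} ≤ dim⟨∂^{=e} IMM^m_n⟩_{=τ}`" (the tree's named fact
`GesmundoLandsberg2017_thm2` = barrier `UnpaddedShiftedPartials`).

**What is proved here** (`perm_le_imm_shiftedPartialsRank`, every field of characteristic `0`, every
injective coordinate inclusion `ι` of the `m²` permanent variables into the `mn²` variables of
`IMM^m_n`): the inequality for all `(e, τ)` with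

  `⌈m/2⌉ ≤ e`  (Case 1 of the printed proof, §4)   or   `τ ≤ m³`  (Case 2),

for `n > m⁵`. This is exactly the range the printed argument establishes:

* Case 1 (`s ≥ ⌈m/2⌉`, all `τ`; printed p. 9): degenerate `IMM^m_n` to `F = qᵏ` / `y qᵏ`
  (`exists_endOrbit_immPoly_eq_sumSq_pow`, `exists_endOrbit_immPoly_eq_X_mul_sumSq_pow`, our
  coordinate version of GL Prop. 9 with `q` on the permanent's own `m²` variables), whose order-`s`
  derivatives span all forms of degree `m - s` in those variables (Reznick / GL Thm. 4,
  `monomial_mem_span_derivSet_sumSq_pow`), so its shifted partials contain every monomial of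
  `Z`-degree `≥ m - s` — a superset of the support of the permanent's shifted partials
  (`shiftedPartialsRank_le_card_filter` / `card_filter_le_shiftedPartialsRank`); ranks do not
  increase under degeneration (`shiftedPartialsRank_le_of_mem_endOrbit`, ELSW §1.1, proved in the tree).
* Case 2 (`s < ⌈m/2⌉`; printed p. 9 with the range "`τ < 2m³`"): `F = qᵏ` on `n` variables
  `V₁ ⊇` (permanent variables); `⟨∂^{=s} F⟩_τ ⊇ q^{k-s} · {monomials of `V₁`-degree ≥ s}` (for `qᵏ`
  this is the EXACT dimension, so Macaulay's theorem / ELSW Cor. 2.4 invoked in print is not needed: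
  "equality holds in the case `m` is even"), against the crude bound
  `binom(m,s)² · binom(N+τ-1, τ)` for the permanent (tree: `shiftedPartialsRank_le_mul_choose`,
  `flatteningRank_perPoly`); the comparison is monomial counting split along `V₁`
  (`card_finsuppAntidiag_univ_le_sum`, `sum_card_le_card_filter`) and the printed estimate
  `(n+τ)/(τ+s) > m²` in the form `binom(m,s)² binom(n+i-1,i) ≤ binom(n+s+i-1, s+i)` for `i ≤ m³`
  (`choose_sq_mul_choose_le`).

**What is NOT proved, and why** (recorded in the barrier file's docstring): the printed Case 2 closes
with "`(n+τ)/(τ+s) > m²`, which holds when `n ≥ m⁵` and `τ ≤ 2m³`" — for `n = m⁵ + 1`, `s = 1`,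
`τ = 2m³ - 1` the quotient is `≈ m²/2`, so the estimate as printed supports `τ ≤ m³` (proved here), not
`τ < 2m³`; and the printed Case 3 (`s < m/2`, `τ > m³`) degenerates `IMM^m_n` to the power sum
`P = y_1^m + ⋯ + y_{m²}^m` and argues in `m²` variables for shifts `> m³` only, whereas padding to the
`mn²` variables mixes ALL shifts `≤ τ` (`dim⟨∂^s p⟩^V_τ = Σ_j dim⟨∂^s p⟩^{V₁}_j · #Mon_{τ-j}(V ∖ V₁)`):
every order-`s` derivative of `P` is a multiple of some `y_i^{m-s}`, so
`dim⟨∂^{=s} P⟩_τ ≤ m² binom(N+τ-1,τ)`, while the `binom(m,s)²` sub-permanents times the monomials in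
the other `N - m²` variables are independent, `dim⟨∂^{=s} perm_m⟩_τ ≥ binom(m,s)² binom(N-m²+τ-1,τ)` —
for `2 ≤ s ≤ m - 2` and `m³ < τ ≲ N/m²` the displayed degeneration is too small, and no other
argument is printed for that range. The full Theorem 2 therefore remains the named fact
`GesmundoLandsberg2017_thm2`; this file discharges its printed range.

## References

* [GesmundoLandsberg2017] F. Gesmundo, J. M. Landsberg, Theory Comput. 15 (2019), art. 3
  (arXiv:1705.03866), Thm. 2, Thm. 4, Prop. 9, §4.
* [EfremenkoLandsbergSchenckWeyman2018] K. Efremenko, J. M. Landsberg, H. Schenck, J. Weyman, Math.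
  Comp. 87 (2018), §1.1 (monotonicity under `End(W)`).
-/

noncomputable section

namespace Literature.Barriers.ValiantsHypothesis

open MvPolynomial Literature.Computability.AlgebraicComplexity

/-! ### Counting monomials split along a set of variables -/

section Counting

variable {σ : Type*} [DecidableEq σ] [Fintype σ]

/-- Splitting a monomial into its `Z`-part and its `Zᶜ`-part:
`#Mon_τ(σ) ≤ Σ_{i ≤ τ} #Mon_i(Z) · #Mon_{τ-i}(Zᶜ)` (in fact an equality; Vandermonde for multisets).
[folklore] -/
theorem card_finsuppAntidiag_univ_le_sum (Z : Finset σ) (τ : ℕ) :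
    ((Finset.univ : Finset σ).finsuppAntidiag τ).card ≤
      ∑ i ∈ Finset.range (τ + 1), (Z.finsuppAntidiag i).card * (Zᶜ.finsuppAntidiag (τ - i)).card := by
  classical
  set S : Finset (Σ _ : ℕ, (σ →₀ ℕ) × (σ →₀ ℕ)) :=
    (Finset.range (τ + 1)).sigma fun i => Z.finsuppAntidiag i ×ˢ Zᶜ.finsuppAntidiag (τ - i) with hS
  have hcard : S.card =
      ∑ i ∈ Finset.range (τ + 1), (Z.finsuppAntidiag i).card * (Zᶜ.finsuppAntidiag (τ - i)).card := by
    rw [hS, Finset.card_sigma]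
    simp only [Finset.card_product]
  rw [← hcard]
  refine Finset.card_le_card_of_injOn (fun μ : σ →₀ ℕ =>
    (⟨∑ u ∈ Z, μ u, (μ.filter (· ∈ Z), μ.filter (· ∉ Z))⟩ : Σ _ : ℕ, (σ →₀ ℕ) × (σ →₀ ℕ))) ?_ ?_
  · intro μ hμ
    rw [Finset.mem_coe, Finset.mem_finsuppAntidiag] at hμ
    obtain ⟨hsum, -⟩ := hμ
    have hsplit : ∑ u ∈ Z, μ u + ∑ u ∈ Zᶜ, μ u = τ := by rw [Finset.sum_add_sum_compl]; exact hsum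
    simp only [Finset.mem_coe, hS, Finset.mem_sigma, Finset.mem_range, Finset.mem_product,
      Finset.mem_finsuppAntidiag]
    refine ⟨by omega, ⟨?_, ?_⟩, ⟨?_, ?_⟩⟩
    · exact Finset.sum_congr rfl fun u hu => Finsupp.filter_apply_pos (· ∈ Z) μ hu
    · intro u hu
      rw [Finsupp.support_filter, Finset.mem_filter] at hu
      exact hu.2
    · rw [show τ - ∑ u ∈ Z, μ u = ∑ u ∈ Zᶜ, μ u by omega]
      exact Finset.sum_congr rfl fun u hu => Finsupp.filter_apply_pos (· ∉ Z) μ (Finset.mem_compl.1 hu)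
    · intro u hu
      rw [Finsupp.support_filter, Finset.mem_filter] at hu
      exact Finset.mem_compl.2 hu.2
  · intro μ _ μ' _ h
    simp only [Sigma.mk.injEq, heq_eq_eq, Prod.mk.injEq] at h
    obtain ⟨-, h1, h2⟩ := h
    rw [← Finsupp.filter_add_filter_not μ (· ∈ Z), ← Finsupp.filter_add_filter_not μ' (· ∈ Z), h1]
    exact congrArg _ h2

/-- Gluing a `Z`-part of degree `d + i` to a `Zᶜ`-part of degree `τ - i`:
`Σ_{i ≤ τ} #Mon_{d+i}(Z) · #Mon_{τ-i}(Zᶜ) ≤ #{μ ∈ Mon_{d+τ}(σ) : Z-degree(μ) ≥ d}`. [folklore] -/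
theorem sum_card_le_card_filter (Z : Finset σ) (d τ : ℕ) :
    ∑ i ∈ Finset.range (τ + 1), (Z.finsuppAntidiag (d + i)).card * (Zᶜ.finsuppAntidiag (τ - i)).card ≤
      (((Finset.univ : Finset σ).finsuppAntidiag (d + τ)).filter fun μ => d ≤ ∑ u ∈ Z, μ u).card := by
  classical
  set S : Finset (Σ _ : ℕ, (σ →₀ ℕ) × (σ →₀ ℕ)) :=
    (Finset.range (τ + 1)).sigma fun i => Z.finsuppAntidiag (d + i) ×ˢ Zᶜ.finsuppAntidiag (τ - i)
    with hS
  have hcard : S.card = ∑ i ∈ Finset.range (τ + 1),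
      (Z.finsuppAntidiag (d + i)).card * (Zᶜ.finsuppAntidiag (τ - i)).card := by
    rw [hS, Finset.card_sigma]
    simp only [Finset.card_product]
  rw [← hcard]
  -- supports in `Z` / `Zᶜ` kill the complementary sums
  have hzero : ∀ (A : Finset σ) (ν : σ →₀ ℕ), ν.support ⊆ Aᶜ → ∑ u ∈ A, ν u = 0 := by
    intro A ν hν
    refine Finset.sum_eq_zero fun u hu => Finsupp.notMem_support_iff.1 fun h => ?_
    exact (Finset.mem_compl.1 (hν h)) hu
  have hfilt : ∀ (A : Finset σ) (ν₁ ν₂ : σ →₀ ℕ), ν₁.support ⊆ A → ν₂.support ⊆ Aᶜ →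
      (ν₁ + ν₂).filter (· ∈ A) = ν₁ := by
    intro A ν₁ ν₂ h1 h2
    rw [Finsupp.filter_add, (Finsupp.filter_eq_self_iff (· ∈ A) ν₁).2 fun x hx =>
      h1 (Finsupp.mem_support_iff.2 hx), (Finsupp.filter_eq_zero_iff (· ∈ A) ν₂).2 fun x hx =>
      Finsupp.notMem_support_iff.1 fun h => (Finset.mem_compl.1 (h2 h)) hx, add_zero]
  refine Finset.card_le_card_of_injOn (fun x : (Σ _ : ℕ, (σ →₀ ℕ) × (σ →₀ ℕ)) => x.2.1 + x.2.2) ?_ ?_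
  · rintro ⟨i, μ₁, μ₂⟩ hx
    simp only [Finset.mem_coe, hS, Finset.mem_sigma, Finset.mem_range, Finset.mem_product,
      Finset.mem_finsuppAntidiag] at hx
    obtain ⟨hi, ⟨h1, hs1⟩, ⟨h2, hs2⟩⟩ := hx
    have hz2 : ∑ u ∈ Z, μ₂ u = 0 := hzero Z μ₂ hs2
    have hz1 : ∑ u ∈ Zᶜ, μ₁ u = 0 := hzero Zᶜ μ₁ (by rw [compl_compl]; exact hs1)
    simp only [Finset.mem_coe, Finset.mem_filter, Finset.mem_finsuppAntidiag]
    refine ⟨⟨?_, Finset.subset_univ _⟩, ?_⟩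
    · rw [← Finset.sum_add_sum_compl Z]
      simp only [Finsupp.add_apply, Finset.sum_add_distrib, h1, hz2, hz1, h2]
      omega
    · simp only [Finsupp.add_apply, Finset.sum_add_distrib, h1, hz2]
      omega
  · rintro ⟨i, μ₁, μ₂⟩ hx ⟨i', μ₁', μ₂'⟩ hx' h
    simp only [Finset.mem_coe, hS, Finset.mem_sigma, Finset.mem_range, Finset.mem_product,
      Finset.mem_finsuppAntidiag] at hx hx'
    dsimp only at h
    obtain ⟨-, ⟨h1, hs1⟩, ⟨-, hs2⟩⟩ := hx
    obtain ⟨-, ⟨h1', hs1'⟩, ⟨-, hs2'⟩⟩ := hx'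
    have e1 : μ₁ = μ₁' := by
      rw [← hfilt Z μ₁ μ₂ hs1 hs2, ← hfilt Z μ₁' μ₂' hs1' hs2']
      exact congrArg _ h
    have e2 : μ₂ = μ₂' := by
      have hs1c : μ₁.support ⊆ Zᶜᶜ := by rw [compl_compl]; exact hs1
      have hs1c' : μ₁'.support ⊆ Zᶜᶜ := by rw [compl_compl]; exact hs1'
      rw [← hfilt Zᶜ μ₂ μ₁ hs2 hs1c, ← hfilt Zᶜ μ₂' μ₁' hs2' hs1c', add_comm μ₂, add_comm μ₂']
      exact congrArg _ h
    subst e1 e2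
    have : i = i' := by omega
    subst this
    rfl

end Counting

/-! ### The printed numerical estimate of Case 2 -/

section Numeric

/-- **GL §4, Case 2, the closing estimate** in binomial form: for `n > m⁵`, `2s ≤ m` and `i ≤ m³`,
`binom(m,s)² · binom(n+i-1, i) ≤ binom(n+s+i-1, s+i)` — from the printed sufficient condition
`(n+τ)/(τ+s) > m²` ("which holds when `n ≥ m⁵`"; with `n = m⁵ + 1` it holds for `τ ≤ m³`):
`binom(n+s+i-1,s+i) binom(s+i,s) = binom(n+s+i-1,s) binom(n+i-1,i)` and
`binom(m,s)² binom(s+i,s) s! ≤ m^{2s} (s+i)^s ≤ (n+i)^s ≤ binom(n+s+i-1,s) s!`.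
[cite: GesmundoLandsberg2017, §4 (Case 2)] -/
theorem choose_sq_mul_choose_le {m n s i : ℕ} (hs : 2 * s ≤ m) (hi : i ≤ m ^ 3) (hn : m ^ 5 < n) :
    (m.choose s) ^ 2 * (n + i - 1).choose i ≤ (n + (s + i) - 1).choose (s + i) := by
  have hn1 : 1 ≤ n := by omega
  set a := n + (s + i) - 1 with ha
  -- the linear estimate `m² (s + i) ≤ n + i`
  have key : m ^ 2 * (s + i) ≤ n + i := by
    have h1 : m ^ 2 * s ≤ m ^ 3 := by
      calc m ^ 2 * s ≤ m ^ 2 * m := Nat.mul_le_mul_left _ (by omega)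
        _ = m ^ 3 := by ring
    have h2 : m ^ 2 * i + m ^ 3 ≤ m ^ 5 + i := by
      rcases Nat.eq_zero_or_pos m with rfl | hm
      · simp
      · have hm2 : 1 ≤ m ^ 2 := Nat.one_le_pow _ _ hm
        have h3 : (m ^ 2 - 1) * i ≤ (m ^ 2 - 1) * m ^ 3 := Nat.mul_le_mul_left _ hi
        have h4 : m ^ 2 * i = (m ^ 2 - 1) * i + i := by
          rw [Nat.sub_mul, one_mul, Nat.sub_add_cancel (Nat.le_mul_of_pos_left i (by omega))]
        have h5 : (m ^ 2 - 1) * m ^ 3 + m ^ 3 = m ^ 5 := by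
          rw [Nat.sub_mul, one_mul, Nat.sub_add_cancel (Nat.le_mul_of_pos_left _ (by omega))]
          ring
        omega
    rw [mul_add]
    omega
  -- `binom(m,s)² binom(s+i,s) ≤ binom(a,s)` through descending factorials
  have hkey : (m.choose s) ^ 2 * (s + i).choose s ≤ a.choose s := by
    have hfac : 0 < s.factorial := Nat.factorial_pos s
    refine Nat.le_of_mul_le_mul_left ?_ hfac
    rw [← mul_assoc, mul_comm s.factorial, mul_assoc, ← Nat.descFactorial_eq_factorial_mul_choose,
      ← Nat.descFactorial_eq_factorial_mul_choose]
    calc (m.choose s) ^ 2 * (s + i).descFactorial s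
        ≤ (m ^ s) ^ 2 * (s + i) ^ s :=
          Nat.mul_le_mul (Nat.pow_le_pow_left (Nat.choose_le_pow m s) 2) (Nat.descFactorial_le_pow _ _)
      _ = (m ^ 2 * (s + i)) ^ s := by rw [mul_pow, ← pow_mul, ← pow_mul, Nat.mul_comm s 2]
      _ ≤ (n + i) ^ s := Nat.pow_le_pow_left key s
      _ = (a + 1 - s) ^ s := by rw [ha]; congr 1; omega
      _ ≤ a.descFactorial s := Nat.pow_sub_le_descFactorial a s
  -- `binom(a, s+i) binom(s+i, s) = binom(a, s) binom(n+i-1, i)`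
  have hid : a.choose (s + i) * (s + i).choose s = a.choose s * (n + i - 1).choose i := by
    rw [Nat.choose_mul (Nat.le_add_right s i)]
    congr 2 <;> omega
  have hpos : 0 < (s + i).choose s := Nat.choose_pos (Nat.le_add_right s i)
  refine Nat.le_of_mul_le_mul_right ?_ hpos
  rw [hid, mul_assoc, mul_comm ((n + i - 1).choose i), ← mul_assoc]
  exact Nat.mul_le_mul_right _ hkey

end Numeric

/-! ### The two cases -/

section Helpers

variable {α : Type*}

/-- If fewer points are enumerated than there are, some point is missed. [folklore] -/
theorem exists_not_mem_range_of_lt_card [Fintype α] {z : ℕ} (v : Fin z → α) (h : z < Fintype.card α) :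
    ∃ y : α, y ∉ Set.range v := by
  by_contra hall
  push Not at hall
  have := Fintype.card_le_of_surjective v fun u => hall u
  rw [Fintype.card_fin] at this
  omega

/-- Supports inside the image of `ι` lie in the range of the enumeration `ι ∘ finProdFinEquiv⁻¹`. [folklore] -/
theorem coe_subset_range_comp {m : ℕ} [DecidableEq α] (ι : Fin m × Fin m → α) {γ : α →₀ ℕ}
    (h : γ.support ⊆ Finset.univ.image ι) :
    (↑γ.support : Set α) ⊆ Set.range (ι ∘ finProdFinEquiv.symm) := by
  intro u hu
  obtain ⟨p, -, rfl⟩ := Finset.mem_image.1 (h (Finset.mem_coe.1 hu))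
  exact ⟨finProdFinEquiv p, by simp⟩

/-- A superset of prescribed size, enumerated injectively. [folklore] -/
theorem exists_superset_enum [Fintype α] [DecidableEq α] (Z : Finset α) {n : ℕ} (hZ : Z.card ≤ n)
    (hn : n ≤ Fintype.card α) :
    ∃ (V : Finset α) (v : Fin n → α), Z ⊆ V ∧ V.card = n ∧ Function.Injective v ∧
      (∀ i, v i ∈ V) ∧ ∀ u ∈ V, u ∈ Set.range v := by
  obtain ⟨V, hZV, -, hVcard⟩ :=
    Finset.exists_subsuperset_card_eq (Finset.subset_univ Z) hZ (by rwa [Finset.card_univ])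
  have hVcard' : Fintype.card ↥V = n := by rw [Fintype.card_coe, hVcard]
  refine ⟨V, fun i => ((Fintype.equivFinOfCardEq hVcard').symm i : α), hZV, hVcard, ?_, ?_, ?_⟩
  · exact fun i j h => (Fintype.equivFinOfCardEq hVcard').symm.injective (Subtype.ext h)
  · exact fun i => ((Fintype.equivFinOfCardEq hVcard').symm i).2
  · exact fun u hu => ⟨Fintype.equivFinOfCardEq hVcard' ⟨u, hu⟩, by simp⟩

end Helpers

section Cases

variable (K : Type) [Field K]

/-- The permanent side, crudely: `rank((perm_m)_{(e,m-e)[τ]}) ≤ binom(m,e)² · binom(N+τ-1, τ)` in the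
`N = mn²` variables ("The space `⟨∂^{=s} perm_m⟩_0` has dimension `binom(m,s)²` ... Ignoring syzygies").
[cite: GesmundoLandsberg2017, §4 (Case 2)] -/
theorem shiftedPartialsRank_rename_perPoly_le_mul {m n : ℕ} (ι : Fin m × Fin m → Fin m × Fin n × Fin n)
    (hι : Function.Injective ι) (e τ : ℕ) :
    shiftedPartialsRank K e τ (rename ι (perPoly (Fin m) K)) ≤
      (m.choose e) ^ 2 * (Fintype.card (Fin m × Fin n × Fin n) + τ - 1).choose τ := by
  refine (shiftedPartialsRank_le_mul_choose e τ _).trans (Nat.mul_le_mul_right _ ?_)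
  rw [← flatteningRank_perPoly K m e]
  exact shiftedPartialsRank_zero_rename_le hι e _

/-- The permanent side through the support: for `e ≤ m`, the shifted partials of the relabelled
permanent are supported on the monomials of degree `m - e + τ` with degree `≥ m - e` in the permanent's
variables `Z = ι(m × m)` ("considering `perm_m` as a polynomial that just involves `m²` of the `mn²`
variables"). [cite: GesmundoLandsberg2017, Thm. 2 and §4 (Case 1)] -/
theorem shiftedPartialsRank_rename_perPoly_le_card {m n : ℕ} (ι : Fin m × Fin m → Fin m × Fin n × Fin n)
    (e τ : ℕ) :
    shiftedPartialsRank K e τ (rename ι (perPoly (Fin m) K)) ≤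
      (((Finset.univ : Finset (Fin m × Fin n × Fin n)).finsuppAntidiag (m - e + τ)).filter
        fun μ => m - e ≤ ∑ u ∈ Finset.univ.image ι, μ u).card := by
  classical
  have hhom : (rename ι (perPoly (Fin m) K)).IsHomogeneous m := by
    have := (perPoly_isHomogeneous (n := Fin m) (k := K)).rename_isHomogeneous (f := ι)
    simpa using this
  have hvars : (rename ι (perPoly (Fin m) K)).vars ⊆ Finset.univ.image ι := by
    intro u hu
    have := vars_rename ι _ hu
    rw [Finset.mem_image] at this ⊢
    obtain ⟨p, -, hp⟩ := this
    exact ⟨p, Finset.mem_univ _, hp⟩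
  exact shiftedPartialsRank_le_card_filter hhom hvars e τ

/-- **The counting chain of Case 2**: for `2e ≤ m`, `τ ≤ m³`, `n > m⁵` and a set `V₁` of `n` variables,
`binom(m,e)² binom(N+τ-1,τ) ≤ Σ_i binom(m,e)² #Mon_i(V₁) #Mon_{τ-i}(V₁ᶜ) ≤ Σ_i #Mon_{e+i}(V₁) #Mon_{τ-i}(V₁ᶜ)
≤ #T(V₁, e, τ)`. [cite: GesmundoLandsberg2017, §4 (Case 2)] -/
theorem choose_sq_mul_le_card_filter {σ : Type*} [Fintype σ] [DecidableEq σ] {m n e τ : ℕ}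
    (he : 2 * e ≤ m) (hτ : τ ≤ m ^ 3) (hn : m ^ 5 < n) (V₁ : Finset σ) (hV : V₁.card = n) :
    (m.choose e) ^ 2 * (Fintype.card σ + τ - 1).choose τ ≤
      (((Finset.univ : Finset σ).finsuppAntidiag (e + τ)).filter fun μ => e ≤ ∑ u ∈ V₁, μ u).card := by
  have h1 := card_finsuppAntidiag_univ_le_sum V₁ τ
  rw [Finset.card_finsuppAntidiag_nat_eq_choose, Finset.card_univ] at h1
  refine (Nat.mul_le_mul_left _ h1).trans ?_
  rw [Finset.mul_sum]
  refine le_trans (Finset.sum_le_sum fun i hi => ?_) (sum_card_le_card_filter V₁ e τ)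
  rw [Finset.mem_range] at hi
  rw [← mul_assoc]
  refine Nat.mul_le_mul_right _ ?_
  rw [Finset.card_finsuppAntidiag_nat_eq_choose, Finset.card_finsuppAntidiag_nat_eq_choose, hV]
  exact choose_sq_mul_choose_le he (by omega) hn

variable [CharZero K]

/-- **Case 1 of the printed proof, even `m = 2k`** (`k ≤ e ≤ 2k`, every `τ`, `m² ≤ n`):
`rank((perm_m)_{(e,·)[τ]}) ≤ #T(Z, m-e, τ) ≤ rank(F_{(e,·)[τ]}) ≤ rank((IMM^m_n)_{(e,·)[τ]})` with
`F = qᵏ`, `q` the sum of the squares of the permanent's `m²` variables `Z`.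
[cite: GesmundoLandsberg2017, Thm. 2 and §4 (Case 1)] -/
theorem perm_le_imm_case1_even {k n : ℕ} (hmn : (2 * (k + 1)) * (2 * (k + 1)) ≤ n) [NeZero n]
    (ι : Fin (2 * (k + 1)) × Fin (2 * (k + 1)) → Fin (2 * (k + 1)) × Fin n × Fin n)
    (hι : Function.Injective ι) (e τ : ℕ) (he1 : k + 1 ≤ e) (he2 : e ≤ 2 * (k + 1)) :
    shiftedPartialsRank K e τ (rename ι (perPoly (Fin (2 * (k + 1))) K)) ≤
      shiftedPartialsRank K e τ (immPoly n (2 * (k + 1)) K) := by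
  classical
  have hvinj : Function.Injective (ι ∘ finProdFinEquiv.symm) := hι.comp finProdFinEquiv.symm.injective
  obtain ⟨G, hG, hGeq⟩ :=
    exists_endOrbit_immPoly_eq_sumSq_pow (K := K) (n := n) hmn k (ι ∘ finProdFinEquiv.symm)
  refine (shiftedPartialsRank_rename_perPoly_le_card K ι e τ).trans
    (le_trans ?_ (shiftedPartialsRank_le_of_mem_endOrbit hG e τ))
  rw [hGeq]
  refine card_filter_le_shiftedPartialsRank (K := K) _ (2 * (k + 1) - e) τ e _ 1 one_ne_zero
    fun γ hγ hγZ => ?_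
  rw [one_mul]
  exact monomial_mem_span_derivSet_sumSq_pow hvinj (by positivity) he1 he2 γ hγ
    (coe_subset_range_comp ι hγZ)

/-- **Case 1 of the printed proof, odd `m = 2k+1`** (`k + 1 ≤ e ≤ 2k+1`, every `τ`, `m² ≤ n`,
`2 ≤ n`): as in the even case with `F = X_{y₀} qᵏ`, `y₀` a variable outside the permanent's.
[cite: GesmundoLandsberg2017, Thm. 2 and §4 (Case 1)] -/
theorem perm_le_imm_case1_odd {k n : ℕ} (hmn : (2 * k + 1) * (2 * k + 1) ≤ n) (hn2 : 2 ≤ n) [NeZero n]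
    (ι : Fin (2 * k + 1) × Fin (2 * k + 1) → Fin (2 * k + 1) × Fin n × Fin n)
    (hι : Function.Injective ι) (e τ : ℕ) (he1 : k + 1 ≤ e) (he2 : e ≤ 2 * k + 1) :
    shiftedPartialsRank K e τ (rename ι (perPoly (Fin (2 * k + 1)) K)) ≤
      shiftedPartialsRank K e τ (immPoly n (2 * k + 1) K) := by
  classical
  have hvinj : Function.Injective (ι ∘ finProdFinEquiv.symm) := hι.comp finProdFinEquiv.symm.injective
  have hlt : (2 * k + 1) * (2 * k + 1) < Fintype.card (Fin (2 * k + 1) × Fin n × Fin n) := by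
    simp only [Fintype.card_prod, Fintype.card_fin]
    have h3 : (2 * k + 1) * (2 * k + 1) * 2 ≤ n * n := Nat.mul_le_mul hmn hn2
    nlinarith
  obtain ⟨y₀, hy₀⟩ := exists_not_mem_range_of_lt_card (ι ∘ finProdFinEquiv.symm) hlt
  obtain ⟨G, hG, hGeq⟩ :=
    exists_endOrbit_immPoly_eq_X_mul_sumSq_pow (K := K) (n := n) hmn k (ι ∘ finProdFinEquiv.symm) y₀
  refine (shiftedPartialsRank_rename_perPoly_le_card K ι e τ).trans
    (le_trans ?_ (shiftedPartialsRank_le_of_mem_endOrbit hG e τ))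
  rw [hGeq]
  refine card_filter_le_shiftedPartialsRank (K := K) _ (2 * k + 1 - e) τ e _ 1 one_ne_zero
    fun γ hγ hγZ => ?_
  rw [one_mul]
  exact monomial_mem_span_derivSet_X_mul_sumSq_pow hvinj hy₀ (by positivity) he1 he2 γ hγ
    (coe_subset_range_comp ι hγZ)

/-- **Case 2 of the printed proof, even `m = 2k`** (`e ≤ k`, `2e ≤ m`, `τ ≤ m³`, `n > m⁵`):
`rank((perm_m)_{(e,·)[τ]}) ≤ binom(m,e)² binom(N+τ-1,τ) ≤ #T(V₁, e, τ) ≤ rank(F_{(e,·)[τ]}) ≤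
rank((IMM^m_n)_{(e,·)[τ]})` with `V₁ ⊇ Z` of size `n` and `F = qᵏ`, `q` the sum of squares of the
`V₁`-variables (the lower bound via `q^{k-e} · T(V₁, e, τ) ⊆ ⟨∂^{=e} F⟩_τ`).
[cite: GesmundoLandsberg2017, Thm. 2 and §4 (Case 2)] -/
theorem perm_le_imm_case2_even {k n : ℕ} (hn : (2 * (k + 1)) ^ 5 < n) [NeZero n]
    (ι : Fin (2 * (k + 1)) × Fin (2 * (k + 1)) → Fin (2 * (k + 1)) × Fin n × Fin n)
    (hι : Function.Injective ι) (e τ : ℕ) (he : e ≤ k) (hτ : τ ≤ (2 * (k + 1)) ^ 3) :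
    shiftedPartialsRank K e τ (rename ι (perPoly (Fin (2 * (k + 1))) K)) ≤
      shiftedPartialsRank K e τ (immPoly n (2 * (k + 1)) K) := by
  classical
  have hcardσ : Fintype.card (Fin (2 * (k + 1)) × Fin n × Fin n) = 2 * (k + 1) * (n * n) := by
    simp [Fintype.card_prod, Fintype.card_fin]
  have hZ : (Finset.univ.image ι).card ≤ n := by
    refine Finset.card_image_le.trans ?_
    rw [Finset.card_univ, Fintype.card_prod, Fintype.card_fin]
    calc 2 * (k + 1) * (2 * (k + 1)) ≤ (2 * (k + 1)) ^ 5 := by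
          rw [show (2 * (k + 1)) ^ 5 = 2 * (k + 1) * (2 * (k + 1)) * (2 * (k + 1)) ^ 3 by ring]
          exact Nat.le_mul_of_pos_right _ (by positivity)
      _ ≤ n := hn.le
  have hnσ : n ≤ Fintype.card (Fin (2 * (k + 1)) × Fin n × Fin n) := by
    rw [hcardσ]
    calc n = 1 * (n * 1) := by ring
      _ ≤ 2 * (k + 1) * (n * n) := Nat.mul_le_mul (by omega) (Nat.mul_le_mul_left _ (by omega))
  obtain ⟨V₁, v, -, hVcard, hvinj, hvmem, hVv⟩ := exists_superset_enum (Finset.univ.image ι) hZ hnσ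
  have hsupp : ∀ γ : (Fin (2 * (k + 1)) × Fin n × Fin n) →₀ ℕ, γ.support ⊆ V₁ →
      (↑γ.support : Set _) ⊆ Set.range v := fun γ hγ u hu => hVv u (hγ (Finset.mem_coe.1 hu))
  have hq0 : (∑ i : Fin n, (X (v i) : MvPolynomial (Fin (2 * (k + 1)) × Fin n × Fin n) K) ^ 2) ≠ 0 := by
    rw [← rename_sumSq]
    exact fun h => sumSq_ne_zero (K := K) (n := n) (by omega)
      (rename_injective v hvinj (by rw [h, map_zero]))
  obtain ⟨G, hG, hGeq⟩ := exists_endOrbit_immPoly_eq_sumSq_pow (K := K) (n := n) le_rfl k v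
  refine (shiftedPartialsRank_rename_perPoly_le_mul K ι hι e τ).trans
    ((choose_sq_mul_le_card_filter (by omega) hτ hn V₁ hVcard).trans
      (le_trans ?_ (shiftedPartialsRank_le_of_mem_endOrbit hG e τ)))
  rw [hGeq]
  exact card_filter_le_shiftedPartialsRank (K := K) V₁ e τ e _ _ (pow_ne_zero _ hq0)
    fun γ hγ hγV => mul_monomial_mem_span_derivSet_sumSq_pow hvinj (by omega) γ hγ (hsupp γ hγV)

/-- **Case 2 of the printed proof, odd `m = 2k+1`** (`e ≤ k`, `τ ≤ m³`, `n > m⁵`): as in the even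
case with `F = X_{y₀} qᵏ`, `y₀` outside `V₁`, and the multiplier `X_{y₀} q^{k-e}`.
[cite: GesmundoLandsberg2017, Thm. 2 and §4 (Case 2)] -/
theorem perm_le_imm_case2_odd {k n : ℕ} (hn : (2 * k + 1) ^ 5 < n) [NeZero n]
    (ι : Fin (2 * k + 1) × Fin (2 * k + 1) → Fin (2 * k + 1) × Fin n × Fin n)
    (hι : Function.Injective ι) (e τ : ℕ) (he : e ≤ k) (hτ : τ ≤ (2 * k + 1) ^ 3) :
    shiftedPartialsRank K e τ (rename ι (perPoly (Fin (2 * k + 1)) K)) ≤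
      shiftedPartialsRank K e τ (immPoly n (2 * k + 1) K) := by
  classical
  have hcardσ : Fintype.card (Fin (2 * k + 1) × Fin n × Fin n) = (2 * k + 1) * (n * n) := by
    simp [Fintype.card_prod, Fintype.card_fin]
  have hn2 : 2 ≤ n := le_trans (by have := Nat.one_le_pow 5 (2 * k + 1) (by omega); omega) hn
  have hZ : (Finset.univ.image ι).card ≤ n := by
    refine Finset.card_image_le.trans ?_
    rw [Finset.card_univ, Fintype.card_prod, Fintype.card_fin]
    calc (2 * k + 1) * (2 * k + 1) ≤ (2 * k + 1) ^ 5 := by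
          rw [show (2 * k + 1) ^ 5 = (2 * k + 1) * (2 * k + 1) * (2 * k + 1) ^ 3 by ring]
          exact Nat.le_mul_of_pos_right _ (by positivity)
      _ ≤ n := hn.le
  have hnσ : n < Fintype.card (Fin (2 * k + 1) × Fin n × Fin n) := by
    rw [hcardσ]
    calc n < n * n := by nlinarith
      _ = 1 * (n * n) := by ring
      _ ≤ (2 * k + 1) * (n * n) := Nat.mul_le_mul_right _ (by omega)
  obtain ⟨V₁, v, -, hVcard, hvinj, hvmem, hVv⟩ := exists_superset_enum (Finset.univ.image ι) hZ hnσ.le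
  have hsupp : ∀ γ : (Fin (2 * k + 1) × Fin n × Fin n) →₀ ℕ, γ.support ⊆ V₁ →
      (↑γ.support : Set _) ⊆ Set.range v := fun γ hγ u hu => hVv u (hγ (Finset.mem_coe.1 hu))
  have hq0 : (∑ i : Fin n, (X (v i) : MvPolynomial (Fin (2 * k + 1) × Fin n × Fin n) K) ^ 2) ≠ 0 := by
    rw [← rename_sumSq]
    exact fun h => sumSq_ne_zero (K := K) (n := n) (by omega)
      (rename_injective v hvinj (by rw [h, map_zero]))
  obtain ⟨y₀, hy₀⟩ := exists_not_mem_range_of_lt_card v hnσ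
  obtain ⟨G, hG, hGeq⟩ := exists_endOrbit_immPoly_eq_X_mul_sumSq_pow (K := K) (n := n) le_rfl k v y₀
  refine (shiftedPartialsRank_rename_perPoly_le_mul K ι hι e τ).trans
    ((choose_sq_mul_le_card_filter (by omega) hτ hn V₁ hVcard).trans
      (le_trans ?_ (shiftedPartialsRank_le_of_mem_endOrbit hG e τ)))
  rw [hGeq]
  exact card_filter_le_shiftedPartialsRank (K := K) V₁ e τ e _
    (X y₀ * (∑ i : Fin n, (X (v i) : MvPolynomial (Fin (2 * k + 1) × Fin n × Fin n) K) ^ 2) ^ (k - e))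
    (mul_ne_zero (X_ne_zero y₀) (pow_ne_zero _ hq0))
    fun γ hγ hγV => X_mul_mul_monomial_mem_span_derivSet hvinj hy₀ he γ hγ (hsupp γ hγV)

end Cases

/-! ### Assembly -/

section Main

variable (K : Type) [Field K]

/-- Scaling a polynomial by a nonzero constant does not change its shifted-partials ranks. [folklore] -/
theorem shiftedPartialsRank_smul {σ : Type*} {c : K} (hc : c ≠ 0) (e τ : ℕ) (f : MvPolynomial σ K) :
    shiftedPartialsRank K e τ (c • f) = shiftedPartialsRank K e τ f := by
  have hset : shiftedPartials e τ (c • f) = (c • LinearMap.id : MvPolynomial σ K →ₗ[K] MvPolynomial σ K) ''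
      shiftedPartials e τ f := by
    ext h
    simp only [shiftedPartials, Set.mem_setOf_eq, Set.mem_image, LinearMap.smul_apply, LinearMap.id_apply]
    constructor
    · rintro ⟨l, β, hl, hβ, rfl⟩
      exact ⟨_, ⟨l, β, hl, hβ, rfl⟩, by rw [iterPDeriv_smul, mul_smul_comm]⟩
    · rintro ⟨_, ⟨l, β, hl, hβ, rfl⟩, rfl⟩
      exact ⟨l, β, hl, hβ, by rw [iterPDeriv_smul, mul_smul_comm]⟩
  have hinj : Function.Injective (c • LinearMap.id : MvPolynomial σ K →ₗ[K] MvPolynomial σ K) :=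
    fun x y hxy => smul_right_injective _ hc hxy
  unfold shiftedPartialsRank
  rw [hset, Submodule.span_image]
  exact ((Submodule.equivMapOfInjective _ hinj _).finrank_eq).symm

variable [CharZero K]

/-- **Gesmundo–Landsberg, Thm. 2, in the range its printed proof establishes — PROVED** (every field of
characteristic `0`): for `n > m⁵`, every injective coordinate inclusion `ι` of the `m²` variables of
`perm_m` into the `mn²` variables of `IMM^m_n`, and all orders `e` and shifts `τ` with
`⌈m/2⌉ ≤ e` (printed Case 1) or `τ ≤ m³` (printed Case 2, whose closing estimate
`(n+τ)/(τ+s) > m²` holds exactly in this range when `n = m⁵ + 1`):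
`dim⟨∂^{=e}(perm_m)⟩_{=τ} ≤ dim⟨∂^{=e} IMM^m_n⟩_{=τ}`. The remaining range `e < ⌈m/2⌉, τ > m³` of the
printed statement rests on the printed Case 3, which does not establish it (module docstring).
[cite: GesmundoLandsberg2017, Thm. 2 and §4 (Cases 1–2)] -/
theorem perm_le_imm_shiftedPartialsRank (m n : ℕ) (hn : m ^ 5 < n)
    (ι : Fin m × Fin m → Fin m × Fin n × Fin n) (hι : Function.Injective ι) (e τ : ℕ)
    (h : (m + 1) / 2 ≤ e ∨ τ ≤ m ^ 3) :
    shiftedPartialsRank K e τ (rename ι (perPoly (Fin m) K)) ≤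
      shiftedPartialsRank K e τ (immPoly n m K) := by
  classical
  haveI : NeZero n := ⟨by omega⟩
  by_cases hem : m < e
  · -- order above the degree: the permanent side vanishes
    refine (shiftedPartialsRank_rename_perPoly_le_mul K ι hι e τ).trans ?_
    rw [Nat.choose_eq_zero_of_lt hem]
    simp
  push Not at hem
  -- parity of `m`; `m = 0` falls under the even case with `k = 0`, handled directly
  obtain ⟨k, rfl | rfl⟩ := Nat.even_or_odd' m
  · cases k with
    | zero =>
      -- `m = 0`: `perm_0 = 1`, `IMM^0_n = n = n • 1`
      have hper : rename ι (perPoly (Fin (2 * 0)) K) = C 1 := by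
        simp [perPoly, Matrix.permanent]
      have himm : immPoly n (2 * 0) K = (n : K) • C 1 := by
        simp [immPoly, immMatrix, Matrix.trace_one, map_natCast, Algebra.smul_def]
      rw [hper, himm, shiftedPartialsRank_smul K (Nat.cast_ne_zero.2 (NeZero.ne n))]
    | succ k =>
      have hm2n : (2 * (k + 1)) * (2 * (k + 1)) ≤ n := by
        calc (2 * (k + 1)) * (2 * (k + 1)) ≤ (2 * (k + 1)) ^ 5 := by
              rw [show (2 * (k + 1)) ^ 5 = 2 * (k + 1) * (2 * (k + 1)) * (2 * (k + 1)) ^ 3 by ring]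
              exact Nat.le_mul_of_pos_right _ (by positivity)
          _ ≤ n := hn.le
      by_cases he : (2 * (k + 1) + 1) / 2 ≤ e
      · exact perm_le_imm_case1_even K hm2n ι hι e τ (by omega) hem
      · have hτ : τ ≤ (2 * (k + 1)) ^ 3 := by
          rcases h with h | h
          · exact (he h).elim
          · exact h
        exact perm_le_imm_case2_even K hn ι hι e τ (by omega) hτ
  · have hn2 : 2 ≤ n := le_trans (by have := Nat.one_le_pow 5 (2 * k + 1) (by omega); omega) hn
    have hm2n : (2 * k + 1) * (2 * k + 1) ≤ n := by
      calc (2 * k + 1) * (2 * k + 1) ≤ (2 * k + 1) ^ 5 := by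
            rw [show (2 * k + 1) ^ 5 = (2 * k + 1) * (2 * k + 1) * (2 * k + 1) ^ 3 by ring]
            exact Nat.le_mul_of_pos_right _ (by positivity)
        _ ≤ n := hn.le
    by_cases he : (2 * k + 1 + 1) / 2 ≤ e
    · exact perm_le_imm_case1_odd K hm2n hn2 ι hι e τ (by omega) hem
    · have hτ : τ ≤ (2 * k + 1) ^ 3 := by
        rcases h with h | h
        · exact (he h).elim
        · exact h
      exact perm_le_imm_case2_odd K hn ι hι e τ (by omega) hτ

/-- The same over `ℂ`, in the shape of the tree's named fact `GesmundoLandsberg2017_thm2` restricted to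
the printed range `⌈m/2⌉ ≤ e ∨ τ ≤ m³`. [cite: GesmundoLandsberg2017, Thm. 2 and §4 (Cases 1–2)] -/
theorem gesmundoLandsberg_thm2_printedRange :
    ∀ m n : ℕ, m ^ 5 < n → ∀ ι : Fin m × Fin m → Fin m × Fin n × Fin n, Function.Injective ι →
      ∀ e τ : ℕ, ((m + 1) / 2 ≤ e ∨ τ ≤ m ^ 3) →
        shiftedPartialsRank ℂ e τ (rename ι (perPoly (Fin m) ℂ)) ≤
          shiftedPartialsRank ℂ e τ (immPoly n m ℂ) :=
  fun m n hn ι hι e τ h => perm_le_imm_shiftedPartialsRank ℂ m n hn ι hι e τ h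

end Main

end Literature.Barriers.ValiantsHypothesis
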